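import Summits.Ventures.LatticeQCDFlow.Exactness.FlowSamplerAutocorrelation
import HarnessLib

/-!
# No converse: a two-state flow/target pair on which the exact sampler is `(4p − 1)/(4p(1 − p))`
# times less efficient than reweighting — unboundedly — and reweighting beats i.i.d. sampling

HONEST FRAMING: exact (Metropolis-corrected) sampling algorithms for lattice gauge theory;
figures of merit are autocorrelation/cost numbers at stated couplings and volumes; no
continuum-physics claim.  (SCALAR calibration rung S0-A: not a gauge result.)

Venture `LatticeQCDFlow` (cell pub-lqcd), topic `Exactness`; FANOUT row 2 (`s0-phi4`, FLOW arm
`imhOp μ w q̃`).  NEW WORK of the cell, companion of `FlowSamplerVsReweighting` (same session):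
there, for every square-integrable observable, the exact flow sampler's asymptotic variance per
model draw is at least that of self-normalised reweighting of the same draws
(`σ²_RW ≤ σ²_chain`, Deligiannidis–Lee 2018 §3.2 NAMED).  Here the other direction is shown to
fail at every constant, by an exact witness in the same vocabulary (`imhOp`, `tauInt`) on the
smallest space: `X = Fin 2` with counting measure, target `w = (p, 1 − p)` (`Z = 1`), the UNIFORM
model `q̃ = (½, ½)`, `½ < p < 1`, and the centred indicator `g = (1 − p, −p)` of the RARE state `1`,
which the model OVER-covers (`b(1)/Z = 2(1 − p) < 1`).  The sampler acts DIAGONALLY on `g`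
(`K g = λ g`, `λ = 1 − 1/(2p)`: on two states every centred function is an eigenfunction), so
everything is in closed form:
`τ_int(g) = 2p − ½`, `σ²_chain(g) = 2 τ_int Var = (4p − 1) p (1 − p)`,
`σ²_RW(g) = E_π[(b/Z) g²] = 4p²(1 − p)²`, `Var_π(g) = p(1 − p)`.
Hence `σ²_chain/σ²_RW = (4p − 1)/(4p(1 − p)) → ∞` as `p → 1` (the chain rejects the fraction
`(2p − 1)/p` of the proposals into the rare state and leaves it at once, reweighting keeps every
draw with its small weight), and `σ²_RW = 4p(1 − p) · Var_π < Var_π`: on this observable reweighting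
beats even i.i.d. sampling from the target, which the exact chain never does (`τ_int ≥ ½`).
Found by hand; verified by `field_simp`/`norm_num`.  Nothing is cited as a fact.

## What is proved (namespace `ReweightingWitness`; `μ = Measure.count` on `Fin 2`; data inline)

* `imhOp_smul`, `iterate_smul` — `K (c·g) = (cλ)·g`, `Kⁿ (c·g) = c λⁿ g`, `λ = 1 − 1/(2p)`;
* `integral_w`, `integral_q`, `integral_g_w`, `sqNorm_g`, `reweightMoment_g` — `Z = 1`, `∫ q̃ = 1`,
  `g` centred, `∫ g² w = p(1 − p)`, `∫ g² b w = 4p²(1 − p)²`;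
* `autocorr` — `ρ(k) = λᵏ`; **`tauInt_eq`** — summable and `τ_int(g) = 2p − ½`;
* **`chainVar_eq`** (`= (4p − 1)p(1 − p)`), **`reweightVar_eq`** (`= 4p²(1 − p)²`),
  `reweightVar_le_chainVar` (the general comparison, checked), **`reweightVar_lt_targetVar`**
  (`σ²_RW < Var_π` for every `p ≠ ½` in range), **`chainVar_div_reweightVar`**
  (`= (4p − 1)/(4p(1 − p))`);
* **`chainVar_gt_mul_reweightVar`** — for every real `C` there is `p ∈ (½, 1)` with
  `σ²_chain(g) > C · σ²_RW(g)`: NO CONVERSE of `σ²_RW ≤ σ²_chain` holds at any constant.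

Reading for S0-A (no numerics implied): observables carried by configurations that the flow
over-covers (common under `q̃`, rare under `e^{−S}`) are exactly where accept/reject wastes draws
relative to reweighting; the factor is unbounded in general.  NOT CLAIMED: that this is typical of
trained flows; any statement at finite `N` (bias of reweighting, burn-in of the chain); any value
for a network; anything on the lattice beyond what `FlowSamplerVsReweighting` proves.
-/

namespace Summit.Ventures.LatticeQCDFlow.Exactness

namespace ReweightingWitness

open Real MeasureTheory Filter Finset Set Topology
open Summit.Ventures.LatticeQCDFlow.Scoring

/-! ## §1 The sampler acts diagonally on the centred indicator -/

/-- **`K (c·g) = c(1 − 1/(2p))·g`**: the exact sampler with uniform model against the target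
`(p, 1 − p)` maps every multiple of `g = (1 − p, −p)` to `λ = 1 − 1/(2p)` times it. -/
theorem imhOp_smul {p : ℝ} (hp : 1 / 2 < p) (hp1 : p < 1) (c : ℝ) :
    imhOp (Measure.count : Measure (Fin 2)) (![p, 1 - p]) (![1 / 2, 1 / 2])
        (fun t => c * (![1 - p, -p] : Fin 2 → ℝ) t)
      = fun t => c * (1 - 1 / (2 * p)) * (![1 - p, -p] : Fin 2 → ℝ) t := by
  funext t
  unfold imhOp imhAcceptQ
  rw [integral_count]
  have hp0 : 0 < p := by linarith
  have h1p : 0 < 1 - p := by linarith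
  have h00 : min (1:ℝ) (p * 2⁻¹ / (p * 2⁻¹)) = 1 := by
    rw [div_self (by positivity), min_self]
  have h11 : min (1:ℝ) ((1 - p) * 2⁻¹ / ((1 - p) * 2⁻¹)) = 1 := by
    rw [div_self (by positivity), min_self]
  have h01 : min (1:ℝ) ((1 - p) * 2⁻¹ / (p * 2⁻¹)) = (1 - p) / p := by
    rw [min_eq_right]
    · field_simp
    · rw [div_le_one (by positivity)]; linarith
  have h10 : min (1:ℝ) (p * 2⁻¹ / ((1 - p) * 2⁻¹)) = 1 := by
    rw [min_eq_left]
    rw [one_le_div (by positivity)]; linarith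
  fin_cases t
  · simp [Fin.sum_univ_two]
    rw [h00, h01]
    field_simp
    ring
  · simp [Fin.sum_univ_two]
    rw [h10, h11]
    field_simp
    ring

/-- `Kⁿ (c·g) = c λⁿ g`. -/
theorem iterate_smul {p : ℝ} (hp : 1 / 2 < p) (hp1 : p < 1) (n : ℕ) (c : ℝ) :
    (imhOp (Measure.count : Measure (Fin 2)) (![p, 1 - p]) (![1 / 2, 1 / 2]))^[n]
        (fun t => c * (![1 - p, -p] : Fin 2 → ℝ) t)
      = fun t => c * (1 - 1 / (2 * p)) ^ n * (![1 - p, -p] : Fin 2 → ℝ) t := by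
  induction n generalizing c with
  | zero => funext t; simp
  | succ n ih =>
    rw [Function.iterate_succ_apply, imhOp_smul hp hp1, ih]
    funext t
    ring

/-- `g = 1·g` (bookkeeping for the iterate lemma). -/
theorem g_eq_one_smul (p : ℝ) :
    (![1 - p, -p] : Fin 2 → ℝ) = fun t => 1 * (![1 - p, -p] : Fin 2 → ℝ) t := by
  funext t; rw [one_mul]

/-! ## §2 The moments: `Z = 1`, `∫ q̃ = 1`, centring, `∫ g² w`, `∫ g² b w` -/

/-- `Z = ∫ w = 1`. -/
theorem integral_w (p : ℝ) :
    ∫ t, (![p, 1 - p] : Fin 2 → ℝ) t ∂(Measure.count : Measure (Fin 2)) = 1 := by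
  rw [integral_count]
  simp [Fin.sum_univ_two]

/-- `∫ q̃ = 1`. -/
theorem integral_q :
    ∫ t, (![1 / 2, 1 / 2] : Fin 2 → ℝ) t ∂(Measure.count : Measure (Fin 2)) = 1 := by
  rw [integral_count]
  simp [Fin.sum_univ_two]
  norm_num

/-- `g` is centred: `∫ g w = 0`. -/
theorem integral_g_w (p : ℝ) :
    ∫ t, (![1 - p, -p] : Fin 2 → ℝ) t * (![p, 1 - p] : Fin 2 → ℝ) t
      ∂(Measure.count : Measure (Fin 2)) = 0 := by
  rw [integral_count]
  simp [Fin.sum_univ_two]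
  ring

/-- `∫ g² w = p(1 − p)` (`= Var_π(g)` since `Z = 1`). -/
theorem sqNorm_g (p : ℝ) :
    ∫ t, (![1 - p, -p] : Fin 2 → ℝ) t ^ 2 * (![p, 1 - p] : Fin 2 → ℝ) t
      ∂(Measure.count : Measure (Fin 2)) = p * (1 - p) := by
  rw [integral_count]
  simp [Fin.sum_univ_two]
  ring

/-- `∫ g² b w = 4p²(1 − p)²` (`b = w/q̃`). -/
theorem reweightMoment_g (p : ℝ) :
    ∫ t, (![1 - p, -p] : Fin 2 → ℝ) t ^ 2
        * ((![p, 1 - p] : Fin 2 → ℝ) t / (![1 / 2, 1 / 2] : Fin 2 → ℝ) t * (![p, 1 - p] : Fin 2 → ℝ) t)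
      ∂(Measure.count : Measure (Fin 2)) = 4 * p ^ 2 * (1 - p) ^ 2 := by
  rw [integral_count]
  simp [Fin.sum_univ_two]
  ring

/-! ## §3 Autocorrelations and `τ_int` in closed form -/

/-- **`ρ(k) = λᵏ`**, `λ = 1 − 1/(2p)`. -/
theorem autocorr {p : ℝ} (hp : 1 / 2 < p) (hp1 : p < 1) (k : ℕ) :
    (∫ x, (![1 - p, -p] : Fin 2 → ℝ) x
        * ((imhOp (Measure.count : Measure (Fin 2)) (![p, 1 - p]) (![1 / 2, 1 / 2]))^[k]
            (![1 - p, -p] : Fin 2 → ℝ)) x * (![p, 1 - p] : Fin 2 → ℝ) x ∂Measure.count)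
      / ∫ x, (![1 - p, -p] : Fin 2 → ℝ) x ^ 2 * (![p, 1 - p] : Fin 2 → ℝ) x ∂Measure.count
      = (1 - 1 / (2 * p)) ^ k := by
  have hp0 : 0 < p := by linarith
  have h1p : 0 < 1 - p := by linarith
  rw [sqNorm_g]
  conv_lhs => rw [g_eq_one_smul p, iterate_smul hp hp1 k 1]
  rw [integral_count]
  simp [Fin.sum_univ_two]
  field_simp
  ring

/-- `0 < λ < 1` for `½ < p < 1`. -/
theorem eigenvalue_bounds {p : ℝ} (hp : 1 / 2 < p) (hp1 : p < 1) :
    0 < 1 - 1 / (2 * p) ∧ 1 - 1 / (2 * p) < 1 := by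
  have hp0 : 0 < p := by linarith
  constructor
  · rw [sub_pos, div_lt_one (by positivity)]; linarith
  · have : 0 < 1 / (2 * p) := by positivity
    linarith

/-- **`τ_int(g) = 2p − ½`**, the series being summable (`½ + λ/(1 − λ)`, `λ/(1 − λ) = 2p − 1`). -/
theorem tauInt_eq {p : ℝ} (hp : 1 / 2 < p) (hp1 : p < 1) :
    (Summable fun n => (∫ x, (![1 - p, -p] : Fin 2 → ℝ) x
        * ((imhOp (Measure.count : Measure (Fin 2)) (![p, 1 - p]) (![1 / 2, 1 / 2]))^[n + 1]
            (![1 - p, -p] : Fin 2 → ℝ)) x * (![p, 1 - p] : Fin 2 → ℝ) x ∂Measure.count)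
      / ∫ x, (![1 - p, -p] : Fin 2 → ℝ) x ^ 2 * (![p, 1 - p] : Fin 2 → ℝ) x ∂Measure.count) ∧
    tauInt (fun n => (∫ x, (![1 - p, -p] : Fin 2 → ℝ) x
        * ((imhOp (Measure.count : Measure (Fin 2)) (![p, 1 - p]) (![1 / 2, 1 / 2]))^[n]
            (![1 - p, -p] : Fin 2 → ℝ)) x * (![p, 1 - p] : Fin 2 → ℝ) x ∂Measure.count)
      / ∫ x, (![1 - p, -p] : Fin 2 → ℝ) x ^ 2 * (![p, 1 - p] : Fin 2 → ℝ) x ∂Measure.count)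
      = 2 * p - 1 / 2 := by
  have hp0 : 0 < p := by linarith
  obtain ⟨hl0, hl1⟩ := eigenvalue_bounds hp hp1
  have h := hasSum_geometric_succ (r := 1 - 1 / (2 * p)) (by rw [abs_of_pos hl0]; exact hl1)
  simp only [autocorr hp hp1]
  refine ⟨h.summable, ?_⟩
  unfold tauInt
  rw [h.tsum_eq]
  field_simp
  ring

/-! ## §4 The two variances and their ratio -/

/-- **`σ²_chain(g) = 2 τ_int(g) · (∫ g² w)/Z = (4p − 1) p (1 − p)`** — the limiting `N·variance` of
the exact chain's ergodic average of `g` over `N` proposals. -/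
theorem chainVar_eq {p : ℝ} (hp : 1 / 2 < p) (hp1 : p < 1) :
    2 * tauInt (fun n => (∫ x, (![1 - p, -p] : Fin 2 → ℝ) x
        * ((imhOp (Measure.count : Measure (Fin 2)) (![p, 1 - p]) (![1 / 2, 1 / 2]))^[n]
            (![1 - p, -p] : Fin 2 → ℝ)) x * (![p, 1 - p] : Fin 2 → ℝ) x ∂Measure.count)
      / ∫ x, (![1 - p, -p] : Fin 2 → ℝ) x ^ 2 * (![p, 1 - p] : Fin 2 → ℝ) x ∂Measure.count)
      * ((∫ x, (![1 - p, -p] : Fin 2 → ℝ) x ^ 2 * (![p, 1 - p] : Fin 2 → ℝ) x ∂Measure.count)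
          / ∫ z, (![p, 1 - p] : Fin 2 → ℝ) z ∂Measure.count)
      = (4 * p - 1) * p * (1 - p) := by
  rw [(tauInt_eq hp hp1).2, sqNorm_g, integral_w]
  ring

/-- **`σ²_RW(g) = Z⁻² ∫ g² b w = 4p²(1 − p)²`** — the limiting `N·variance` of self-normalised
reweighting of `N` model draws. -/
theorem reweightVar_eq (p : ℝ) :
    (∫ t, (![1 - p, -p] : Fin 2 → ℝ) t ^ 2
        * ((![p, 1 - p] : Fin 2 → ℝ) t / (![1 / 2, 1 / 2] : Fin 2 → ℝ) t
          * (![p, 1 - p] : Fin 2 → ℝ) t) ∂(Measure.count : Measure (Fin 2)))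
      / (∫ z, (![p, 1 - p] : Fin 2 → ℝ) z ∂(Measure.count : Measure (Fin 2))) ^ 2
      = 4 * p ^ 2 * (1 - p) ^ 2 := by
  rw [reweightMoment_g, integral_w]
  simp

/-- The general comparison `σ²_RW ≤ σ²_chain` (`FlowSamplerVsReweighting`), checked on the witness:
`4p²(1 − p)² ≤ (4p − 1) p (1 − p)` (`⇔ 4p(1 − p) ≤ 4p − 1 ⇔ (2p − 1)² ≥ 0`… here `p ≥ ½`). -/
theorem reweightVar_le_chainVar {p : ℝ} (hp : 1 / 2 < p) (hp1 : p < 1) :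
    4 * p ^ 2 * (1 - p) ^ 2 ≤ (4 * p - 1) * p * (1 - p) := by
  have hp0 : 0 < p := by linarith
  have h1p : 0 < 1 - p := by linarith
  have key : (4 * p - 1) * p * (1 - p) - 4 * p ^ 2 * (1 - p) ^ 2
      = p * (1 - p) * (4 * p ^ 2 - 1) := by ring
  have h4 : 0 ≤ 4 * p ^ 2 - 1 := by nlinarith
  have h0 : 0 ≤ p * (1 - p) * (4 * p ^ 2 - 1) := mul_nonneg (mul_nonneg hp0.le h1p.le) h4
  linarith

/-- **REWEIGHTING BEATS I.I.D. SAMPLING FROM THE TARGET on this observable**: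
`σ²_RW(g) = 4p(1 − p) · Var_π(g) < Var_π(g) = p(1 − p)` — impossible for the exact chain
(`σ²_chain ≥ Var_π`, `τ_int ≥ ½`). -/
theorem reweightVar_lt_targetVar {p : ℝ} (hp : 1 / 2 < p) (hp1 : p < 1) :
    (∫ t, (![1 - p, -p] : Fin 2 → ℝ) t ^ 2
        * ((![p, 1 - p] : Fin 2 → ℝ) t / (![1 / 2, 1 / 2] : Fin 2 → ℝ) t
          * (![p, 1 - p] : Fin 2 → ℝ) t) ∂(Measure.count : Measure (Fin 2)))
      / (∫ z, (![p, 1 - p] : Fin 2 → ℝ) z ∂(Measure.count : Measure (Fin 2))) ^ 2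
      < (∫ x, (![1 - p, -p] : Fin 2 → ℝ) x ^ 2 * (![p, 1 - p] : Fin 2 → ℝ) x ∂Measure.count)
          / ∫ z, (![p, 1 - p] : Fin 2 → ℝ) z ∂Measure.count := by
  rw [reweightVar_eq, sqNorm_g, integral_w, div_one]
  have hp0 : 0 < p := by linarith
  have h1p : 0 < 1 - p := by linarith
  have hq : 4 * p * (1 - p) < 1 := by nlinarith
  have e : 4 * p ^ 2 * (1 - p) ^ 2 = (4 * p * (1 - p)) * (p * (1 - p)) := by ring
  rw [e]
  exact mul_lt_of_lt_one_left (mul_pos hp0 h1p) hq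

/-- **`σ²_chain(g)/σ²_RW(g) = (4p − 1)/(4p(1 − p))`**. -/
theorem chainVar_div_reweightVar {p : ℝ} (hp : 1 / 2 < p) (hp1 : p < 1) :
    (2 * tauInt (fun n => (∫ x, (![1 - p, -p] : Fin 2 → ℝ) x
        * ((imhOp (Measure.count : Measure (Fin 2)) (![p, 1 - p]) (![1 / 2, 1 / 2]))^[n]
            (![1 - p, -p] : Fin 2 → ℝ)) x * (![p, 1 - p] : Fin 2 → ℝ) x ∂Measure.count)
      / ∫ x, (![1 - p, -p] : Fin 2 → ℝ) x ^ 2 * (![p, 1 - p] : Fin 2 → ℝ) x ∂Measure.count)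
      * ((∫ x, (![1 - p, -p] : Fin 2 → ℝ) x ^ 2 * (![p, 1 - p] : Fin 2 → ℝ) x ∂Measure.count)
          / ∫ z, (![p, 1 - p] : Fin 2 → ℝ) z ∂Measure.count))
      / ((∫ t, (![1 - p, -p] : Fin 2 → ℝ) t ^ 2
          * ((![p, 1 - p] : Fin 2 → ℝ) t / (![1 / 2, 1 / 2] : Fin 2 → ℝ) t
            * (![p, 1 - p] : Fin 2 → ℝ) t) ∂(Measure.count : Measure (Fin 2)))
        / (∫ z, (![p, 1 - p] : Fin 2 → ℝ) z ∂(Measure.count : Measure (Fin 2))) ^ 2)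
      = (4 * p - 1) / (4 * p * (1 - p)) := by
  rw [chainVar_eq hp hp1, reweightVar_eq]
  have hp0 : 0 < p := by linarith
  have h1p : 0 < 1 - p := by linarith
  field_simp

/-- `(4p − 1)/(4p(1 − p))` is unbounded on `(½, 1)`: for every `C` some `p ∈ (½, 1)` exceeds it. -/
theorem ratio_unbounded (C : ℝ) :
    ∃ p : ℝ, 1 / 2 < p ∧ p < 1 ∧ C < (4 * p - 1) / (4 * p * (1 - p)) := by
  set M : ℝ := max C 1 with hM
  have hM1 : 1 ≤ M := le_max_right _ _
  have hMC : C ≤ M := le_max_left _ _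
  have hM0 : 0 < M := by linarith
  refine ⟨1 - 1 / (4 * (M + 1)), ?_, ?_, ?_⟩
  · have : 1 / (4 * (M + 1)) ≤ 1 / 8 := by
      rw [div_le_div_iff₀ (by positivity) (by norm_num)]; linarith
    linarith
  · have : 0 < 1 / (4 * (M + 1)) := by positivity
    linarith
  · have hε : 0 < 1 / (4 * (M + 1)) := by positivity
    have hε' : 1 / (4 * (M + 1)) ≤ 1 / 8 := by
      rw [div_le_div_iff₀ (by positivity) (by norm_num)]; linarith
    set ε : ℝ := 1 / (4 * (M + 1)) with hεdef
    have hden : 0 < 4 * (1 - ε) * (1 - (1 - ε)) := by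
      have : 1 - (1 - ε) = ε := by ring
      rw [this]; exact mul_pos (by linarith) hε
    rw [lt_div_iff₀ hden]
    -- `C · 4(1−ε)ε < 3 − 4ε`: indeed `4(1−ε)ε ≤ 4ε = 1/(M+1)` and `C ≤ M`, `3 − 4ε ≥ 5/2`
    have hεM : ε * (M + 1) = 1 / 4 := by
      rw [hεdef]; field_simp
    nlinarith [hεM, hMC, hM1, hε, hε']

/-- **NO CONVERSE AT ANY CONSTANT.**  For every real `C` there is `p ∈ (½, 1)` such that, for the
target `w = (p, 1 − p)`, the uniform model `q̃ = (½, ½)` and the centred observable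
`g = (1 − p, −p)` on two states (counting measure), the exact sampler's asymptotic variance per
draw exceeds `C` times that of self-normalised reweighting:
`2 τ_int(g) · (∫ g² w)/Z > C · Z⁻² ∫ g² b w`. -/
theorem chainVar_gt_mul_reweightVar (C : ℝ) :
    ∃ p : ℝ, 1 / 2 < p ∧ p < 1 ∧
      C * ((∫ t, (![1 - p, -p] : Fin 2 → ℝ) t ^ 2
          * ((![p, 1 - p] : Fin 2 → ℝ) t / (![1 / 2, 1 / 2] : Fin 2 → ℝ) t
            * (![p, 1 - p] : Fin 2 → ℝ) t) ∂(Measure.count : Measure (Fin 2)))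
        / (∫ z, (![p, 1 - p] : Fin 2 → ℝ) z ∂(Measure.count : Measure (Fin 2))) ^ 2)
      < 2 * tauInt (fun n => (∫ x, (![1 - p, -p] : Fin 2 → ℝ) x
        * ((imhOp (Measure.count : Measure (Fin 2)) (![p, 1 - p]) (![1 / 2, 1 / 2]))^[n]
            (![1 - p, -p] : Fin 2 → ℝ)) x * (![p, 1 - p] : Fin 2 → ℝ) x ∂Measure.count)
      / ∫ x, (![1 - p, -p] : Fin 2 → ℝ) x ^ 2 * (![p, 1 - p] : Fin 2 → ℝ) x ∂Measure.count)
      * ((∫ x, (![1 - p, -p] : Fin 2 → ℝ) x ^ 2 * (![p, 1 - p] : Fin 2 → ℝ) x ∂Measure.count)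
          / ∫ z, (![p, 1 - p] : Fin 2 → ℝ) z ∂Measure.count) := by
  obtain ⟨p, hp, hp1, hC⟩ := ratio_unbounded C
  refine ⟨p, hp, hp1, ?_⟩
  rw [chainVar_eq hp hp1, reweightVar_eq]
  have hp0 : 0 < p := by linarith
  have h1p : 0 < 1 - p := by linarith
  have hpos : 0 < 4 * p ^ 2 * (1 - p) ^ 2 := by positivity
  rw [lt_div_iff₀ (by positivity)] at hC
  nlinarith [hC, mul_pos hp0 h1p]

end ReweightingWitness

end Summit.Ventures.LatticeQCDFlow.Exactness
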